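import Summits.CriticalPhenomena.PercolationContinuityZ3.Theorems.PercNearOneGluingNoHeavyLowerTailSunflowerPrincipalCore
import Literature.Probability.LatticeModels.ProdBernoulliIndependence
import HarnessLib

/-!
# `NoHeavyLowerTail` (crux stmt-CriticalPhenomena-4575), abstract sunflower cubic: SAFE CORES — the calculus, part 1
# (definition, principal filters, closure under conjunction on disjoint blocks, and the law-level rows for any safe core)

Support file (seat `prim-ineq-prove-1` gen 34; `--supports stmt-CriticalPhenomena-4575`).  No `sorry`, no named facts.  Memo:
run/shared/lean/prim/prim-ineq-prove-1/FINDING-PRINCIPALCORE-prove1-g34.md §9 (the closure calculus).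

SETTING.  `μ = prodBernoulli p` on the cube `Set ι`.  An event `A` (the prospective core of a sunflower) is **SAFE** for `p`
(`SafeCalc.Safe p A`) when Lemma A holds for every family of up-sets meeting pairwise inside `A`:
`∀ n, ∀ V : Fin n → up-sets, (∀ i ≠ j, V i ∩ V j ⊆ A) → ∏_i μ(V i) ≤ μ(A)^(n−1)`.
On a safe core every law-level row of the lane holds with NO density hypothesis (`lemmaA_of_safe`, `e3_le_core_mul_AG_of_safe`,
(C1-law) `e3_le_max_mul_AG_of_safe`, `lawH_nonneg_of_safe`, `AG_ge_e3_of_safe`, Kahn's Conjecture 5 on the complements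
`sahiE3_compl_nonneg_of_safe`).  The Δ-system-core theorem (`…SunflowerDeltaCore`) says Δ-system cores are safe; this file starts
an ALGEBRA of safe cores:
* `safe_principal` — principal filters `{g ⊆ ω}` are safe (`PrincipalCore.prod_real_le_real_core_pow`); `safe_univ`.
* **`safe_inter`** — CONJUNCTION ON DISJOINT BLOCKS: if `A₁` is determined by the coordinates in `a`, `A₂` by those outside `a`,
  and both are safe, then `A₁ ∩ A₂` is safe.  PROOF (three lines, memo §9 (i)): `V ⊆ capIn a V ∩ capOut a V` where
  `capIn a V = {ω | ω ∪ aᶜ ∈ V}` is determined by `a` and `capOut a V = {ω | ω ∪ a ∈ V}` by `aᶜ`; the `capIn a (V i)` meet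
  pairwise inside `A₁`, the `capOut a (V i)` inside `A₂`; independence of the two blocks and the two safety hypotheses give
  `∏ μ(V i) ≤ ∏ μ(capIn)·∏ μ(capOut) ≤ μ(A₁)^(n−1) μ(A₂)^(n−1) = μ(A₁ ∩ A₂)^(n−1)`.
Part 2 (`…SunflowerGradedSafe`) adds GRADED safety and the disjunction rules (`A₁ ∪ A₂` safe when `A₁` is gradedly safe and
`A₂` safe; graded safety closed under disjunction; principal filters gradedly safe = the K-decreasing-functions lemma), which
together prove Lemma A unconditionally for every core built from read-once DNFs by disjoint conjunctions and by disjunctions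
with read-once DNFs — e.g. `(x₁ ∨ x₂)(x₃ ∨ x₄)`, `x₁(x₂ ∨ x₃(x₄ ∨ x₅))`, `x₂x₃ ∨ x₁(x₄ ∨ x₅)`, all Δ-system cores, and every
read-once core on ≤ 5 coordinates (memo §9; exact census: every read-once core on ≤ 7 coordinates is safe numerically).
-/

noncomputable section

namespace Summit.CriticalPhenomena.PercolationContinuityZ3.Theorems.SunflowerPartition

namespace SafeCalc

open MeasureTheory Finset
open Literature.Probability.LatticeModels Literature.Probability.Percolation

variable {ι : Type*}

/-! ## Safe cores -/

/-- **Safe core.**  `A` is safe for `p` when every finite family of up-sets with pairwise intersections inside `A` satisfies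
`∏_i μ(V i) ≤ μ(A)^(n−1)` (Lemma A in product form, all numbers of petals). [this work] -/
def Safe (p : ι → unitInterval) (A : Set (Set ι)) : Prop :=
  ∀ (n : ℕ) (V : Fin n → Set (Set ι)), (∀ i, IsUpperSet (V i)) → (∀ i j, i ≠ j → V i ∩ V j ⊆ A) →
    ∏ i, (prodBernoulli p).real (V i) ≤ ((prodBernoulli p).real A) ^ (n - 1)

/-- Safety for families indexed by an arbitrary finite type. [this work] -/
theorem Safe.prod_le {p : ι → unitInterval} {A : Set (Set ι)} (hA : Safe p A) {κ : Type*} [Fintype κ]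
    {V : κ → Set (Set ι)} (hV : ∀ i, IsUpperSet (V i)) (hcap : ∀ i j, i ≠ j → V i ∩ V j ⊆ A) :
    ∏ i, (prodBernoulli p).real (V i) ≤ ((prodBernoulli p).real A) ^ (Fintype.card κ - 1) := by
  classical
  let e := Fintype.equivFin κ
  have h := hA (Fintype.card κ) (fun k => V (e.symm k)) (fun k => hV _)
    (fun k l hkl => hcap _ _ fun h => hkl (e.symm.injective h))
  rwa [Fintype.prod_equiv e.symm (fun k => (prodBernoulli p).real (V (e.symm k)))
    (fun i => (prodBernoulli p).real (V i)) (fun k => rfl)] at h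

/-- Principal filters are safe (`PrincipalCore.prod_real_le_real_core_pow`, the T1 theorem). [this work] -/
theorem safe_principal (p : ι → unitInterval) (g : Finset ι) : Safe p {ω | (g : Set ι) ⊆ ω} := by
  intro n V hV hcap
  have h := PrincipalCore.prod_real_le_real_core_pow p hV g hcap
  rwa [Fintype.card_fin] at h

/-- The whole cube is safe (trivially: every factor is at most `1`). [this work] -/
theorem safe_univ (p : ι → unitInterval) : Safe p (Set.univ : Set (Set ι)) := by
  intro n V _ _
  rw [probReal_univ, one_pow]
  exact Finset.prod_le_one (fun i _ => measureReal_nonneg) fun i _ => measureReal_le_one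

/-! ## Conjunction on disjoint blocks -/

section Inter

/-- `capIn a V = {ω | ω ∪ aᶜ ∈ V}`: `V` holds once every coordinate OUTSIDE the block `a` is switched on. [this work] -/
def capIn (a : Finset ι) (V : Set (Set ι)) : Set (Set ι) := {ω | ω ∪ (↑a : Set ι)ᶜ ∈ V}

/-- `capOut a V = {ω | ω ∪ a ∈ V}`: `V` holds once every coordinate INSIDE the block `a` is switched on. [this work] -/
def capOut (a : Finset ι) (V : Set (Set ι)) : Set (Set ι) := {ω | ω ∪ (↑a : Set ι) ∈ V}

variable (a : Finset ι)

/-- An up-set lies in both of its caps. [this work] -/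
theorem subset_capIn_inter_capOut {V : Set (Set ι)} (hV : IsUpperSet V) : V ⊆ capIn a V ∩ capOut a V :=
  fun _ hω => ⟨hV Set.subset_union_left hω, hV Set.subset_union_left hω⟩

/-- `capIn` of an up-set is an up-set. [this work] -/
theorem isUpperSet_capIn {V : Set (Set ι)} (hV : IsUpperSet V) : IsUpperSet (capIn a V) :=
  fun _ _ hle hω => hV (Set.union_subset_union_left _ hle) hω

/-- `capOut` of an up-set is an up-set. [this work] -/
theorem isUpperSet_capOut {V : Set (Set ι)} (hV : IsUpperSet V) : IsUpperSet (capOut a V) :=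
  fun _ _ hle hω => hV (Set.union_subset_union_left _ hle) hω

/-- `capIn` commutes with intersections. [this work] -/
theorem capIn_inter (V W : Set (Set ι)) : capIn a (V ∩ W) = capIn a V ∩ capIn a W := rfl

/-- `capOut` commutes with intersections. [this work] -/
theorem capOut_inter (V W : Set (Set ι)) : capOut a (V ∩ W) = capOut a V ∩ capOut a W := rfl

/-- `capIn` is monotone in the event. [this work] -/
theorem capIn_mono {V W : Set (Set ι)} (h : V ⊆ W) : capIn a V ⊆ capIn a W := fun _ hω => h hω

/-- `capOut` is monotone in the event. [this work] -/
theorem capOut_mono {V W : Set (Set ι)} (h : V ⊆ W) : capOut a V ⊆ capOut a W := fun _ hω => h hω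

/-- `capIn a V` is determined by the block `a`. [this work] -/
theorem determinedBy_capIn (V : Set (Set ι)) : DeterminedBy (capIn a V) (↑a : Set ι) := by
  rw [determinedBy_iff]
  intro ω ω' h
  have key : ∀ x, x ∈ (↑a : Set ι) → (x ∈ ω ↔ x ∈ ω') := fun x hx =>
    ⟨fun h1 => ((Set.ext_iff.1 h x).1 ⟨h1, hx⟩).1, fun h1 => ((Set.ext_iff.1 h x).2 ⟨h1, hx⟩).1⟩
  have hset : ω ∪ (↑a : Set ι)ᶜ = ω' ∪ (↑a : Set ι)ᶜ := by
    ext x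
    simp only [Set.mem_union, Set.mem_compl_iff]
    by_cases hx : x ∈ (↑a : Set ι)
    · simp only [hx, not_true_eq_false, or_false]; exact key x hx
    · simp only [hx, not_false_eq_true, or_true]
  simp only [capIn, Set.mem_setOf_eq, hset]

/-- `capOut a V` is determined by the complement of the block `a`. [this work] -/
theorem determinedBy_capOut (V : Set (Set ι)) : DeterminedBy (capOut a V) (↑a : Set ι)ᶜ := by
  rw [determinedBy_iff]
  intro ω ω' h
  have key : ∀ x, x ∉ (↑a : Set ι) → (x ∈ ω ↔ x ∈ ω') := fun x hx =>
    ⟨fun h1 => ((Set.ext_iff.1 h x).1 ⟨h1, hx⟩).1, fun h1 => ((Set.ext_iff.1 h x).2 ⟨h1, hx⟩).1⟩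
  have hset : ω ∪ (↑a : Set ι) = ω' ∪ (↑a : Set ι) := by
    ext x
    simp only [Set.mem_union]
    by_cases hx : x ∈ (↑a : Set ι)
    · simp only [hx, or_true]
    · simp only [hx, or_false]; exact key x hx
  simp only [capOut, Set.mem_setOf_eq, hset]

/-- An event determined by `a` is its own `capIn`. [this work] -/
theorem capIn_eq_of_determinedBy {A : Set (Set ι)} (hA : DeterminedBy A (↑a : Set ι)) : capIn a A = A := by
  ext ω
  simp only [capIn, Set.mem_setOf_eq]
  refine (determinedBy_iff A _).1 hA _ _ ?_
  rw [Set.union_inter_distrib_right, Set.compl_inter_self, Set.union_empty]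

/-- An event determined by `aᶜ` is its own `capOut`. [this work] -/
theorem capOut_eq_of_determinedBy {A : Set (Set ι)} (hA : DeterminedBy A (↑a : Set ι)ᶜ) : capOut a A = A := by
  ext ω
  simp only [capOut, Set.mem_setOf_eq]
  refine (determinedBy_iff A _).1 hA _ _ ?_
  rw [Set.union_inter_distrib_right, Set.inter_compl_self, Set.union_empty]

/-- **SAFE CORES ARE CLOSED UNDER CONJUNCTION ON DISJOINT BLOCKS** (memo §9 (i)).  If `A₁` is determined by the coordinates in
`a` and safe, and `A₂` is determined by the coordinates outside `a` and safe, then `A₁ ∩ A₂` is safe. [this work] -/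
theorem safe_inter [Fintype ι] (p : ι → unitInterval) {A₁ A₂ : Set (Set ι)}
    (hd₁ : DeterminedBy A₁ (↑a : Set ι)) (hd₂ : DeterminedBy A₂ (↑a : Set ι)ᶜ)
    (h₁ : Safe p A₁) (h₂ : Safe p A₂) : Safe p (A₁ ∩ A₂) := by
  classical
  intro n V hV hcap
  have hIn : ∀ i j, i ≠ j → capIn a (V i) ∩ capIn a (V j) ⊆ A₁ := by
    intro i j hij
    rw [← capIn_inter, ← capIn_eq_of_determinedBy a hd₁]
    exact capIn_mono a ((hcap i j hij).trans Set.inter_subset_left)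
  have hOut : ∀ i j, i ≠ j → capOut a (V i) ∩ capOut a (V j) ⊆ A₂ := by
    intro i j hij
    rw [← capOut_inter, ← capOut_eq_of_determinedBy a hd₂]
    exact capOut_mono a ((hcap i j hij).trans Set.inter_subset_right)
  have k₁ := h₁ n (fun i => capIn a (V i)) (fun i => isUpperSet_capIn a (hV i)) hIn
  have k₂ := h₂ n (fun i => capOut a (V i)) (fun i => isUpperSet_capOut a (hV i)) hOut
  have hle : ∀ i, (prodBernoulli p).real (V i) ≤
      (prodBernoulli p).real (capIn a (V i)) * (prodBernoulli p).real (capOut a (V i)) := by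
    intro i
    rw [← prodBernoulli_real_inter_of_determinedBy p a (determinedBy_capIn a (V i)) (determinedBy_capOut a (V i))
      MeasurableSet.of_discrete MeasurableSet.of_discrete]
    exact measureReal_mono (subset_capIn_inter_capOut a (hV i))
  have hA : (prodBernoulli p).real (A₁ ∩ A₂) = (prodBernoulli p).real A₁ * (prodBernoulli p).real A₂ :=
    prodBernoulli_real_inter_of_determinedBy p a hd₁ hd₂ MeasurableSet.of_discrete MeasurableSet.of_discrete
  calc ∏ i, (prodBernoulli p).real (V i)
      ≤ ∏ i, ((prodBernoulli p).real (capIn a (V i)) * (prodBernoulli p).real (capOut a (V i))) :=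
        Finset.prod_le_prod (fun i _ => measureReal_nonneg) fun i _ => hle i
    _ = (∏ i, (prodBernoulli p).real (capIn a (V i))) * ∏ i, (prodBernoulli p).real (capOut a (V i)) :=
        Finset.prod_mul_distrib
    _ ≤ ((prodBernoulli p).real A₁) ^ (n - 1) * ((prodBernoulli p).real A₂) ^ (n - 1) :=
        mul_le_mul k₁ k₂ (Finset.prod_nonneg fun i _ => measureReal_nonneg) (pow_nonneg measureReal_nonneg _)
    _ = ((prodBernoulli p).real (A₁ ∩ A₂)) ^ (n - 1) := by rw [hA, mul_pow]

end Inter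

/-! ## The law-level rows on a safe core -/

section Rows

/-- **Lemma A on a safe core.**  Three up-sets with all pairwise intersections equal to a safe `A`:
`μ(E₁) μ(E₂) μ(E₃) ≤ μ(A)²`. [this work] -/
theorem lemmaA_of_safe (p : ι → unitInterval) {E₁ E₂ E₃ A : Set (Set ι)} (hS : Safe p A) (h₁ : IsUpperSet E₁)
    (h₂ : IsUpperSet E₂) (h₃ : IsUpperSet E₃) (h12 : E₁ ∩ E₂ = A) (h13 : E₁ ∩ E₃ = A) (h23 : E₂ ∩ E₃ = A) :
    (prodBernoulli p).real E₁ * (prodBernoulli p).real E₂ * (prodBernoulli p).real E₃ ≤ ((prodBernoulli p).real A) ^ 2 := by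
  let V : Fin 3 → Set (Set ι) := ![E₁, E₂, E₃]
  have hV : ∀ i, IsUpperSet (V i) := by
    intro i; fin_cases i
    · exact h₁
    · exact h₂
    · exact h₃
  have hcap' : ∀ i j, i ≠ j → V i ∩ V j ⊆ A := by
    intro i j hij
    fin_cases i <;> fin_cases j
    all_goals first
      | exact (hij rfl).elim
      | (change E₁ ∩ E₂ ⊆ A; exact h12.le)
      | (change E₂ ∩ E₁ ⊆ A; rw [Set.inter_comm]; exact h12.le)
      | (change E₁ ∩ E₃ ⊆ A; exact h13.le)
      | (change E₃ ∩ E₁ ⊆ A; rw [Set.inter_comm]; exact h13.le)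
      | (change E₂ ∩ E₃ ⊆ A; exact h23.le)
      | (change E₃ ∩ E₂ ⊆ A; rw [Set.inter_comm]; exact h23.le)
  have key := hS 3 V hV hcap'
  rw [Fin.prod_univ_three] at key
  simp only [V, Matrix.cons_val_zero, Matrix.cons_val_one, Matrix.cons_val] at key
  calc (prodBernoulli p).real E₁ * (prodBernoulli p).real E₂ * (prodBernoulli p).real E₃
      ≤ ((prodBernoulli p).real A) ^ (3 - 1) := key
    _ = ((prodBernoulli p).real A) ^ 2 := by norm_num

variable [Finite ι]

/-- **Lemma A in cells** on a safe core: `c₁c₂c₃ ≤ a·(ab − (c₁c₂ + c₁c₃ + c₂c₃))`. [this work] -/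
theorem e3_le_core_mul_AG_of_safe (p : ι → unitInterval) {E₁ E₂ E₃ A : Set (Set ι)} (hS : Safe p A) (h₁ : IsUpperSet E₁)
    (h₂ : IsUpperSet E₂) (h₃ : IsUpperSet E₃) (h12 : E₁ ∩ E₂ = A) (h13 : E₁ ∩ E₃ = A) (h23 : E₂ ∩ E₃ = A) :
    (prodBernoulli p).real (E₁ \ A) * (prodBernoulli p).real (E₂ \ A) * (prodBernoulli p).real (E₃ \ A) ≤
      (prodBernoulli p).real A * ((prodBernoulli p).real A * (prodBernoulli p).real (E₁ ∪ E₂ ∪ E₃)ᶜ -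
        ((prodBernoulli p).real (E₁ \ A) * (prodBernoulli p).real (E₂ \ A) +
          (prodBernoulli p).real (E₁ \ A) * (prodBernoulli p).real (E₃ \ A) +
          (prodBernoulli p).real (E₂ \ A) * (prodBernoulli p).real (E₃ \ A))) := by
  have key := lemmaA_of_safe p hS h₁ h₂ h₃ h12 h13 h23
  obtain ⟨e₁, e₂, e₃, eB⟩ := PrincipalCore.cells_eq p h12 h13 h23
  rw [e₁, e₂, e₃] at key
  rw [eB]
  nlinarith [key]

/-- **(C1-law) on a safe core**: `e₃ ≤ max(a,b)·(ab − e₂)`, unconditionally. [this work] -/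
theorem e3_le_max_mul_AG_of_safe (p : ι → unitInterval) {E₁ E₂ E₃ A : Set (Set ι)} (hS : Safe p A) (h₁ : IsUpperSet E₁)
    (h₂ : IsUpperSet E₂) (h₃ : IsUpperSet E₃) (h12 : E₁ ∩ E₂ = A) (h13 : E₁ ∩ E₃ = A) (h23 : E₂ ∩ E₃ = A) :
    (prodBernoulli p).real (E₁ \ A) * (prodBernoulli p).real (E₂ \ A) * (prodBernoulli p).real (E₃ \ A) ≤
      max ((prodBernoulli p).real A) ((prodBernoulli p).real (E₁ ∪ E₂ ∪ E₃)ᶜ) *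
        ((prodBernoulli p).real A * (prodBernoulli p).real (E₁ ∪ E₂ ∪ E₃)ᶜ -
          ((prodBernoulli p).real (E₁ \ A) * (prodBernoulli p).real (E₂ \ A) +
            (prodBernoulli p).real (E₁ \ A) * (prodBernoulli p).real (E₃ \ A) +
            (prodBernoulli p).real (E₂ \ A) * (prodBernoulli p).real (E₃ \ A))) := by
  have hLA := e3_le_core_mul_AG_of_safe p hS h₁ h₂ h₃ h12 h13 h23
  have hAG := prodBernoulli_strongHarris_sunflower_three p h₁ h₂ h₃ h12 h13 h23
  have hmax : (prodBernoulli p).real A ≤ max ((prodBernoulli p).real A) ((prodBernoulli p).real (E₁ ∪ E₂ ∪ E₃)ᶜ) :=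
    le_max_left _ _
  nlinarith [hmax, hAG, hLA]

/-- **The `H`-row on a safe core**: `(a + b)(ab − e₂) ≥ e₃`. [this work] -/
theorem lawH_nonneg_of_safe (p : ι → unitInterval) {E₁ E₂ E₃ A : Set (Set ι)} (hS : Safe p A) (h₁ : IsUpperSet E₁)
    (h₂ : IsUpperSet E₂) (h₃ : IsUpperSet E₃) (h12 : E₁ ∩ E₂ = A) (h13 : E₁ ∩ E₃ = A) (h23 : E₂ ∩ E₃ = A) :
    0 ≤ ((prodBernoulli p).real A + (prodBernoulli p).real (E₁ ∪ E₂ ∪ E₃)ᶜ) *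
        ((prodBernoulli p).real A * (prodBernoulli p).real (E₁ ∪ E₂ ∪ E₃)ᶜ -
          ((prodBernoulli p).real (E₁ \ A) * (prodBernoulli p).real (E₂ \ A) +
            (prodBernoulli p).real (E₁ \ A) * (prodBernoulli p).real (E₃ \ A) +
            (prodBernoulli p).real (E₂ \ A) * (prodBernoulli p).real (E₃ \ A))) -
      (prodBernoulli p).real (E₁ \ A) * (prodBernoulli p).real (E₂ \ A) * (prodBernoulli p).real (E₃ \ A) := by
  have hLA := e3_le_core_mul_AG_of_safe p hS h₁ h₂ h₃ h12 h13 h23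
  have hAG := prodBernoulli_strongHarris_sunflower_three p h₁ h₂ h₃ h12 h13 h23
  have hb : 0 ≤ (prodBernoulli p).real (E₁ ∪ E₂ ∪ E₃)ᶜ := measureReal_nonneg
  nlinarith [hb, hAG, hLA]

/-- **The `G`-row on a safe core**: `ab − e₂ ≥ e₃` (Lemma A and `a ≤ 1`). [this work] -/
theorem AG_ge_e3_of_safe (p : ι → unitInterval) {E₁ E₂ E₃ A : Set (Set ι)} (hS : Safe p A) (h₁ : IsUpperSet E₁)
    (h₂ : IsUpperSet E₂) (h₃ : IsUpperSet E₃) (h12 : E₁ ∩ E₂ = A) (h13 : E₁ ∩ E₃ = A) (h23 : E₂ ∩ E₃ = A) :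
    (prodBernoulli p).real (E₁ \ A) * (prodBernoulli p).real (E₂ \ A) * (prodBernoulli p).real (E₃ \ A) ≤
      (prodBernoulli p).real A * (prodBernoulli p).real (E₁ ∪ E₂ ∪ E₃)ᶜ -
        ((prodBernoulli p).real (E₁ \ A) * (prodBernoulli p).real (E₂ \ A) +
          (prodBernoulli p).real (E₁ \ A) * (prodBernoulli p).real (E₃ \ A) +
          (prodBernoulli p).real (E₂ \ A) * (prodBernoulli p).real (E₃ \ A)) := by
  have hLA := e3_le_core_mul_AG_of_safe p hS h₁ h₂ h₃ h12 h13 h23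
  have hAG := prodBernoulli_strongHarris_sunflower_three p h₁ h₂ h₃ h12 h13 h23
  have ha1 : (prodBernoulli p).real A ≤ 1 := measureReal_le_one
  have ha0 : 0 ≤ (prodBernoulli p).real A := measureReal_nonneg
  nlinarith [ha1, ha0, hAG, hLA]

/-- **Kahn's Conjecture 5 / Sahi `E₃ ≥ 0` for the complements of a sunflower of up-sets with a safe core**:
`E₃(E₁ᶜ, E₂ᶜ, E₃ᶜ) = (1 + a)(ab − e₂) − e₃ ≥ 0` (the `T`-row). [this work] -/
theorem sahiE3_compl_nonneg_of_safe (p : ι → unitInterval) {E₁ E₂ E₃ A : Set (Set ι)} (hS : Safe p A) (h₁ : IsUpperSet E₁)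
    (h₂ : IsUpperSet E₂) (h₃ : IsUpperSet E₃) (h12 : E₁ ∩ E₂ = A) (h13 : E₁ ∩ E₃ = A) (h23 : E₂ ∩ E₃ = A) :
    0 ≤ sahiE3 (prodBernoulli p) E₁ᶜ E₂ᶜ E₃ᶜ := by
  classical
  have m₁ : MeasurableSet E₁ := MeasurableSet.of_discrete
  have m₂ : MeasurableSet E₂ := MeasurableSet.of_discrete
  have m₃ : MeasurableSet E₃ := MeasurableSet.of_discrete
  rw [sahiE3_compl_sunflower_eq (prodBernoulli p) m₁ m₂ m₃ h12 h13 h23]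
  have hLA := e3_le_core_mul_AG_of_safe p hS h₁ h₂ h₃ h12 h13 h23
  have hAG := prodBernoulli_strongHarris_sunflower_three p h₁ h₂ h₃ h12 h13 h23
  have ha0 : 0 ≤ (prodBernoulli p).real A := measureReal_nonneg
  nlinarith [ha0, hAG, hLA]

end Rows

end SafeCalc

end Summit.CriticalPhenomena.PercolationContinuityZ3.Theorems.SunflowerPartition
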